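import Mathlib
import HarnessLib.Audit
import Summits.PneNP.PneNP.Theorems.PstarCentreTwoDirty

/-!
# A centre forces three inside gates — the deletion count in the gated family (ROUND-24, O1; every slack, all sharing patterns; memo g25 §52)

FRONTIER range-avoidance ladder, rung F-N3, ROUND 24 (cell `pnp-ideate`, prover-2 memo `g25/O1-XORSPLIT-g25.md` §52; typed targets
`PstarCoreBoundTargets.TerminalFive` / `TerminalPeelable` (p646951); restricted-model proof complexity — nothing here bears on `P` versus `NP`).

`PstarCentreTwoDirty` runs the deletion inequality in the core `K`.  Running it instead in the GATED FAMILY `F = K ∪ H`, `H ⊆ M` a set of inside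
gates (AND monomials of the menu with both AND inputs read inside `K`) covering the dirty chords (each dirty chord has a private AND slot read by a
member of `H`), sharpens the upper bound: the clean chords of `K` stay chords of `F` (`not_mem_varSet_gate_of_clean`), admissibility in `K` implies
admissibility in `F`, `F ∖ R ⊆ K ∪ M` is expanding, and `#bdry F ≤ #bdry K − #𝒟 + 2·#H` (`card_bdry_union_le`: the covered private slots leave the
boundary, only XOR inputs of gates enter).  The dirty-chord terms cancel and the count reads `3 ≤ #H`:

* **`no_centre_of_gate_cover`**: inside the induction, an X-connected terminal core whose dirty chords are covered by AT MOST TWO inside gates has no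
  centre (every slack, all sharing patterns);
* `no_centre_of_dirty_le_two`, **`exists_three_dirty_of_centre`**: a centre forces three pairwise distinct dirty chords — and, by the first theorem,
  at least three distinct inside gates in every cover.
-/

set_option linter.dupNamespace false -- `Summit.PneNP.PneNP.…`: summit = sub-problem name (D-0017 single-conjunct layout)

open Finset Literature.Computability.Complexity
open Summit.PneNP.PneNP.Theorems.PstarTyped (Typed)
open Summit.PneNP.PneNP.Theorems.PstarSALevel (varSet bdry BoundaryExpanding SimpleOverlap)
open Summit.PneNP.PneNP.Theorems.PstarSAClosure (degIn mem_bdry_iff)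
open Summit.PneNP.PneNP.Theorems.PstarXCore (xpair mem_xpair xverts)
open Summit.PneNP.PneNP.Theorems.PstarCentreFree (vars_mem_varSet)
open Summit.PneNP.PneNP.Theorems.PstarCoreBound (XorClosed)
open Summit.PneNP.PneNP.Theorems.PstarChordRepair (IsChord)
open Summit.PneNP.PneNP.Theorems.PstarCoreBoundTargets (Terminal nonchords mem_nonchords)
open Summit.PneNP.PneNP.Theorems.PstarSharingBound (sharedSlots card_bdry_add_card_sharedSlots_le)
open Summit.PneNP.PneNP.Theorems.PstarChordBridgeTools (xpdeg)
open Summit.PneNP.PneNP.Theorems.PstarChordBridgeExchange (mem_xverts_iff)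
open Summit.PneNP.PneNP.Theorems.PstarNorUnitCoverTools (exists_ne_of_two_le_xpdeg)
open Summit.PneNP.PneNP.Theorems.PstarChordReadOutside (OutsideGated)
open Summit.PneNP.PneNP.Theorems.PstarCleanChordCount (card_nonchords_le_card_sharedSlots)
open Summit.PneNP.PneNP.Theorems.PstarNoFreeVertex (covered_of_terminal mem_varSet_of_mem_xpair mem_xpair_of_mem_varSet)
open Summit.PneNP.PneNP.Theorems.PstarSkeletonSpan (XConnected skel mem_skel skel_subset card_xverts_le_card_skel xverts_mono)
open Summit.PneNP.PneNP.Theorems.PstarSlackTools (three_le_card_xverts_of_leafless two_le_degIn)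
open Summit.PneNP.PneNP.Theorems.PstarSlackTwoTools (card_deg2_chords_le_filter exists_inside_gate not_mem_varSet_gate_of_clean)
open Summit.PneNP.PneNP.Theorems.PstarSlackTwoClean (card_bdry_sdiff_add_le)

namespace Summit.PneNP.PneNP.Theorems.PstarCentreThreeGates

variable {n m : ℕ}

/-! ## The gated family -/

/-- `degIn` of a disjoint union. -/
theorem degIn_union (I : LocalMap 4 n m) {K H : Finset (Fin m)} (hKH : Disjoint K H) (u : Fin n) :
    degIn I (K ∪ H) u = degIn I K u + degIn I H u := by
  classical
  unfold PstarSAClosure.degIn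
  rw [filter_union, card_union_of_disjoint (disjoint_filter_filter hKH)]

/-- **Boundary of the gated family.**  `H` disjoint from `K`, every member of `H` with both AND inputs read inside `K`, and `V ⊆ bdry K` a set of
boundary variables each read by a member of `H`: `#bdry (K ∪ H) + #V ≤ #bdry K + 2·#H`. -/
theorem card_bdry_union_le (I : LocalMap 4 n m) {K H : Finset (Fin m)} (hKH : Disjoint K H)
    (hHin : ∀ h ∈ H, (∃ j ∈ K, I.vars h 2 ∈ varSet I j) ∧ ∃ j ∈ K, I.vars h 3 ∈ varSet I j)
    {V : Finset (Fin n)} (hV : V ⊆ bdry I K) (hVH : ∀ v ∈ V, ∃ h ∈ H, v ∈ varSet I h) :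
    (bdry I (K ∪ H)).card + V.card ≤ (bdry I K).card + 2 * H.card := by
  classical
  have hsub : bdry I (K ∪ H) ⊆ (bdry I K \ V) ∪ H.biUnion fun h => {I.vars h 0, I.vars h 1} := by
    intro u hu
    rw [mem_bdry_iff, degIn_union I hKH] at hu
    rw [mem_union, mem_sdiff, mem_bdry_iff, mem_biUnion]
    by_cases hK : degIn I K u = 1
    · refine Or.inl ⟨hK, fun huV => ?_⟩
      obtain ⟨h, hh, huh⟩ := hVH u huV
      have hpos : 0 < degIn I H u := by
        unfold PstarSAClosure.degIn; exact card_pos.2 ⟨h, mem_filter.2 ⟨hh, huh⟩⟩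
      omega
    · right
      have hH1 : 0 < degIn I H u := by omega
      have hK0 : degIn I K u = 0 := by omega
      unfold PstarSAClosure.degIn at hH1 hK0
      obtain ⟨h, hh⟩ := card_pos.1 hH1
      obtain ⟨hhH, huh⟩ := mem_filter.1 hh
      refine ⟨h, hhH, ?_⟩
      unfold PstarSALevel.varSet at huh
      obtain ⟨s, -, hs⟩ := mem_image.1 huh
      have notin : ∀ j ∈ K, u ∉ varSet I j := fun j hj huj =>
        absurd (card_eq_zero.1 hK0) (ne_empty_of_mem (mem_filter.2 ⟨hj, huj⟩))
      have h4 : ∀ s : Fin 4, s = 0 ∨ s = 1 ∨ s = 2 ∨ s = 3 := by decide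
      rw [mem_insert, mem_singleton]
      rcases h4 s with rfl | rfl | rfl | rfl
      · exact Or.inl hs.symm
      · exact Or.inr hs.symm
      · obtain ⟨j, hj, hj2⟩ := (hHin h hhH).1
        exact absurd (hs ▸ hj2) (notin j hj)
      · obtain ⟨j, hj, hj3⟩ := (hHin h hhH).2
        exact absurd (hs ▸ hj3) (notin j hj)
  calc (bdry I (K ∪ H)).card + V.card ≤ ((bdry I K \ V) ∪ H.biUnion fun h => {I.vars h 0, I.vars h 1}).card + V.card :=
        Nat.add_le_add_right (card_le_card hsub) _
    _ ≤ (bdry I K \ V).card + (H.biUnion fun h => {I.vars h 0, I.vars h 1}).card + V.card :=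
        Nat.add_le_add_right (card_union_le _ _) _
    _ ≤ (bdry I K \ V).card + H.card * 2 + V.card := by
        have := card_biUnion_le_card_mul H (fun h => ({I.vars h 0, I.vars h 1} : Finset (Fin n))) 2 fun h _ => card_le_two
        omega
    _ = (bdry I K).card + 2 * H.card := by rw [card_sdiff_of_subset hV]; have := card_le_card hV; omega

/-- A clean chord of `K` is a chord of the gated family. -/
theorem isChord_union_of_clean (I : LocalMap 4 n m) (hT : Typed I) {K H M : Finset (Fin m)} (hKH : Disjoint K H) (hHM : H ⊆ M)
    (hHin : ∀ h ∈ H, (∃ j ∈ K, I.vars h 2 ∈ varSet I j) ∧ ∃ j ∈ K, I.vars h 3 ∈ varSet I j)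
    {c : Fin m} (hch : IsChord I K c) (hO : OutsideGated I K M c) : IsChord I (K ∪ H) c := by
  classical
  have key : ∀ s : Fin 4, 2 ≤ s.val → I.vars c s ∈ bdry I K → I.vars c s ∈ bdry I (K ∪ H) := by
    intro s hs hb
    rw [mem_bdry_iff] at hb ⊢
    rw [degIn_union I hKH, hb]
    have h0 : degIn I H (I.vars c s) = 0 := by
      unfold PstarSAClosure.degIn
      refine card_eq_zero.2 (filter_eq_empty_iff.2 fun h hh hmem => ?_)
      exact not_mem_varSet_gate_of_clean I hT (hHM hh) (hHin h hh).1 (hHin h hh).2 hO s hs hmem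
    rw [h0]
  exact ⟨key 2 (by decide) hch.1, key 3 (by decide) hch.2⟩

/-! ## The theorem -/

variable {I : LocalMap 4 n m} {r : ℕ} {y : Fin m → Bool} {K : Finset (Fin m)} {w₁ w₂ : Finset (Fin n) × Finset (Fin m) × Bool}

/-- **NO CENTRE UNDER A GATE COVER OF SIZE AT MOST TWO** (every slack, all sharing patterns; inside the core-bound induction).  An X-connected
terminal core whose dirty chords (chords not outside-gated) all have a private AND slot read by one of at most two inside gates `H ⊆ M` (members
of the menu with both AND inputs read inside the core) has no non-empty leafless set of non-chords. -/
theorem no_centre_of_gate_cover (hI : I.IsPure xorAndPred) (hT : Typed I) (hS : SimpleOverlap I) (hB : BoundaryExpanding r I)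
    (ht : Terminal I r y K w₁ w₂)
    (hIH : ∀ c ∈ K, ∀ K₀ ⊆ K.erase c, ∀ d d' : Finset (Fin n) × Finset (Fin m) × Bool, Terminal I r y K₀ d d' → K₀.card ≤ 5)
    (hconn : XConnected I K) {H : Finset (Fin m)} (hHM : H ⊆ w₁.2.1 ∪ w₂.2.1) (hH2 : H.card ≤ 2)
    (hHin : ∀ h ∈ H, (∃ j ∈ K, I.vars h 2 ∈ varSet I j) ∧ ∃ j ∈ K, I.vars h 3 ∈ varSet I j)
    (hcover : ∀ d ∈ K, IsChord I K d → ¬ OutsideGated I K (w₁.2.1 ∪ w₂.2.1) d →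
      ∃ h ∈ H, I.vars d 2 ∈ varSet I h ∨ I.vars d 3 ∈ varSet I h) :
    ¬ ∃ S ⊆ K, S.Nonempty ∧ (∀ w ∈ xverts I S, 2 ≤ xpdeg I S w) ∧ ∀ f ∈ S, ¬ IsChord I K f := by
  classical
  rintro ⟨S, hSK, hSne, hSL, hSnc⟩
  have hX : XorClosed I K := ht.2.1
  have hKr : K.card < r := ht.2.2.1
  set M := w₁.2.1 ∪ w₂.2.1 with hM
  have hbs := card_bdry_add_card_sharedSlots_le I K hX
  have hN := card_nonchords_le_card_sharedSlots I K
  -- the skeleton: non-chords and dirty chords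
  set D := K.filter fun c => IsChord I K c ∧ ¬ OutsideGated I K M c with hDdef
  have hskel : skel I K M ⊆ nonchords I K ∪ D := by
    intro f hf
    obtain ⟨hfK, hnot⟩ := (mem_skel I).1 hf
    by_cases hch : IsChord I K f
    · exact mem_union_right _ (mem_filter.2 ⟨hfK, hch, fun hO => hnot ⟨hch, hO⟩⟩)
    · exact mem_union_left _ ((mem_nonchords I).2 ⟨hfK, hch⟩)
  have hskelcard : (skel I K M).card ≤ (nonchords I K).card + D.card := (card_le_card hskel).trans (card_union_le _ _)
  have hu : (xverts I K).card ≤ (skel I K M).card := card_xverts_le_card_skel hI hT hS hB ht hIH hconn ⟨S, hSK, hSne, hSL, hSnc⟩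
  set C := K.filter fun c => IsChord I K c ∧ OutsideGated I K M c with hC
  have hsplit : C.card + (skel I K M).card = K.card := by
    have h1 := card_filter_add_card_filter_not (s := K) (fun c => IsChord I K c ∧ OutsideGated I K M c)
    have e : (K.filter fun c => ¬ (IsChord I K c ∧ OutsideGated I K M c)) = skel I K M := by
      ext f; rw [mem_filter, mem_skel]
    rw [e] at h1
    exact h1
  set C₂ := C.filter fun c => ∃ w ∈ xpair I c, degIn I K w = 2 with hC₂
  set C'' := C.filter fun c => ¬ ∃ w ∈ xpair I c, degIn I K w = 2 with hC''
  have hCsplit : C₂.card + C''.card = C.card := card_filter_add_card_filter_not _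
  have hcov := covered_of_terminal hI hT hS hB ht
  have hC₂mem : ∀ c ∈ C₂, c ∈ K ∧ IsChord I K c ∧ OutsideGated I K M c ∧ ∃ w ∈ xpair I c, degIn I K w = 2 := fun c hc => by
    obtain ⟨hcC, hw⟩ := mem_filter.1 hc
    obtain ⟨hcK, hch, hO⟩ := mem_filter.1 hcC
    exact ⟨hcK, hch, hO, hw⟩
  have h3 := three_le_card_xverts_of_leafless I hI hS hSne hSL
  -- refined injection: `#C'' ≥ t + 3 − 2·#𝒟 + #Y`
  set Y := (xverts I K \ xverts I S).filter fun v => ¬ degIn I K v = 2 with hY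
  have hC₂f := card_deg2_chords_le_filter I hI hcov hC₂mem hSK hSL hSnc
  have hYsplit : ((xverts I K \ xverts I S).filter fun v => degIn I K v = 2).card + Y.card = (xverts I K \ xverts I S).card :=
    card_filter_add_card_filter_not _
  have hVS : (xverts I K \ xverts I S).card + (xverts I S).card = (xverts I K).card := card_sdiff_add_card_eq_card (xverts_mono I hSK)
  have hC''5 : 2 * (bdry I K).card + 3 + Y.card ≤ C''.card + 3 * K.card + 2 * D.card := by omega
  -- members and fat chords at a vertex
  have memC'' : ∀ c ∈ C'', c ∈ K ∧ IsChord I K c ∧ OutsideGated I K M c ∧ ∀ w ∈ xpair I c, degIn I K w ≠ 2 := fun c hc => by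
    obtain ⟨hcC, hno⟩ := mem_filter.1 hc
    obtain ⟨hcK, hch, hO⟩ := mem_filter.1 hcC
    push Not at hno
    exact ⟨hcK, hch, hO, hno⟩
  -- at every XOR vertex: the fat chords reading it plus one non-clean member
  have fat_lt : ∀ w ∈ xverts I K, (C''.filter fun j => w ∈ varSet I j).card + 1 ≤ degIn I K w := by
    intro w hw
    obtain ⟨f, hf, hwf, hnot⟩ := hcov w hw
    unfold PstarSAClosure.degIn
    have hfC : f ∉ C''.filter fun j => w ∈ varSet I j := fun h => by
      obtain ⟨-, hch, hO, -⟩ := memC'' f (mem_filter.1 h).1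
      exact hnot ⟨hch, hO⟩
    calc (C''.filter fun j => w ∈ varSet I j).card + 1 = (insert f (C''.filter fun j => w ∈ varSet I j)).card := by
          rw [card_insert_of_notMem hfC]
      _ ≤ (K.filter fun j => w ∈ varSet I j).card := by
          refine card_le_card fun j hj => ?_
          rcases mem_insert.1 hj with rfl | hj
          · exact mem_filter.2 ⟨hf, mem_varSet_of_mem_xpair hwf⟩
          · obtain ⟨hjC, hwj⟩ := mem_filter.1 hj
            exact mem_filter.2 ⟨(memC'' j hjC).1, hwj⟩
  -- `W₁`: the vertices all of whose members but one are fat chords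
  set W₁ := (xverts I K).filter fun w => degIn I K w = (C''.filter fun j => w ∈ varSet I j).card + 1 with hW₁
  have hW₁fat : ∀ w ∈ W₁, ∃ c ∈ C'', w ∈ varSet I c := by
    intro w hw
    obtain ⟨hwK, hdw⟩ := mem_filter.1 hw
    by_contra h
    push Not at h
    have h0 : (C''.filter fun j => w ∈ varSet I j).card = 0 := card_eq_zero.2 (filter_eq_empty_iff.2 fun j hj hwj => h j hj hwj)
    rw [h0] at hdw
    -- degree one: an XOR vertex of `K` on the boundary
    obtain ⟨f, hf, hwf⟩ := (mem_xverts_iff I K w).1 hwK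
    have hb : w ∈ bdry I K := (mem_bdry_iff I K w).2 hdw
    rcases (mem_xpair I).1 hwf with h | h
    · exact hX f hf 0 (by decide) (h ▸ hb)
    · exact hX f hf 1 (by decide) (h ▸ hb)
  -- `W₁ ⊆ Y`
  have hW₁Y : W₁ ⊆ Y := by
    intro w hw
    obtain ⟨hwK, hdw⟩ := mem_filter.1 hw
    obtain ⟨c, hc, hwc⟩ := hW₁fat w hw
    obtain ⟨hcK, hch, hO, hno⟩ := memC'' c hc
    have hwx : w ∈ xpair I c := by
      obtain ⟨f, hf, hwf⟩ := (mem_xverts_iff I K w).1 hwK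
      rcases (mem_xpair I).1 hwf with h | h
      · rw [h]; exact mem_xpair_of_mem_varSet hT (s := 0) (by decide) (h ▸ hwc)
      · rw [h]; exact mem_xpair_of_mem_varSet hT (s := 1) (by decide) (h ▸ hwc)
    refine mem_filter.2 ⟨mem_sdiff.2 ⟨hwK, fun hwS => ?_⟩, hno w hwx⟩
    -- a centre vertex carries two members of `S`, which are not fat chords
    obtain ⟨s₁, hs₁, -, hws₁⟩ := exists_ne_of_two_le_xpdeg I hI c (hSL w hwS)
    obtain ⟨s₂, hs₂, hs₂₁, hws₂⟩ := exists_ne_of_two_le_xpdeg I hI s₁ (hSL w hwS)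
    have hsC : ∀ s ∈ S, s ∉ C''.filter fun j => w ∈ varSet I j := fun s hs h =>
      hSnc s hs (memC'' s (mem_filter.1 h).1).2.1
    have hle : (C''.filter fun j => w ∈ varSet I j).card + 2 ≤ degIn I K w := by
      unfold PstarSAClosure.degIn
      have hs₁f : s₁ ∉ C''.filter fun j => w ∈ varSet I j := hsC s₁ hs₁
      have hs₂f : s₂ ∉ insert s₁ (C''.filter fun j => w ∈ varSet I j) := fun h => by
        rcases mem_insert.1 h with h | h
        · exact hs₂₁ h
        · exact hsC s₂ hs₂ h
      calc (C''.filter fun j => w ∈ varSet I j).card + 2 = (insert s₂ (insert s₁ (C''.filter fun j => w ∈ varSet I j))).card := by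
            rw [card_insert_of_notMem hs₂f, card_insert_of_notMem hs₁f]
        _ ≤ (K.filter fun j => w ∈ varSet I j).card := by
            refine card_le_card fun j hj => ?_
            rcases mem_insert.1 hj with rfl | hj
            · exact mem_filter.2 ⟨hSK hs₂, mem_varSet_of_mem_xpair hws₂⟩
            rcases mem_insert.1 hj with rfl | hj
            · exact mem_filter.2 ⟨hSK hs₁, mem_varSet_of_mem_xpair hws₁⟩
            · obtain ⟨hjC, hwj⟩ := mem_filter.1 hj
              exact mem_filter.2 ⟨(memC'' j hjC).1, hwj⟩
    omega
  -- keep one fat chord at each vertex of `W₁`, delete the other fat chords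
  choose κ hκC hκw using hW₁fat
  obtain ⟨s₀, hs₀⟩ := hSne
  set kf : Fin n → Fin m := fun w => if h : w ∈ W₁ then κ w h else s₀ with hkf
  set Kept := W₁.image kf with hKept
  have hKeptC : Kept ⊆ C'' := by
    intro j hj
    obtain ⟨w, hw, rfl⟩ := mem_image.1 hj
    simp only [hkf, dif_pos hw]
    exact hκC w hw
  have hKeptW : Kept.card ≤ W₁.card := card_image_le
  set R := C'' \ Kept with hR
  have hRK : R ⊆ K := fun j hj => (memC'' j (mem_sdiff.1 hj).1).1
  have hRch : ∀ c ∈ R, IsChord I K c := fun j hj => (memC'' j (mem_sdiff.1 hj).1).2.1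
  have hRdeg : ∀ c ∈ R, ∀ w ∈ xpair I c, 2 + (R.filter fun j => w ∈ varSet I j).card ≤ degIn I K w := by
    intro c hc w hw
    have hcC'' : c ∈ C'' := (mem_sdiff.1 hc).1
    have hwK : w ∈ xverts I K := (mem_xverts_iff I K w).2 ⟨c, (memC'' c hcC'').1, hw⟩
    have hsub : (R.filter fun j => w ∈ varSet I j) ⊆ C''.filter fun j => w ∈ varSet I j := filter_subset_filter _ sdiff_subset
    have hfl := fat_lt w hwK
    by_cases hwW : w ∈ W₁
    · -- the kept chord at `w` is fat, reads `w`, and is not deleted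
      have hkw : kf w ∈ C''.filter fun j => w ∈ varSet I j := by
        simp only [hkf, dif_pos hwW]
        exact mem_filter.2 ⟨hκC w hwW, hκw w hwW⟩
      have hkR : kf w ∉ R.filter fun j => w ∈ varSet I j := fun h =>
        (mem_sdiff.1 (mem_filter.1 h).1).2 (mem_image.2 ⟨w, hwW, rfl⟩)
      have hlt : (R.filter fun j => w ∈ varSet I j).card < (C''.filter fun j => w ∈ varSet I j).card :=
        card_lt_card ⟨hsub, fun h => hkR (h hkw)⟩
      have := (mem_filter.1 hwW).2
      omega
    · have hne : degIn I K w ≠ (C''.filter fun j => w ∈ varSet I j).card + 1 := fun h => hwW (mem_filter.2 ⟨hwK, h⟩)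
      have := card_le_card hsub
      omega
  -- the deletion, run in the gated family `F = K ∪ H`
  have hdisj : Disjoint K M := disjoint_union_right.2 ⟨ht.2.2.2.1, ht.2.2.2.2.1⟩
  have hKH : Disjoint K H := hdisj.mono_right hHM
  set F := K ∪ H with hF
  have hRF : R ⊆ F := hRK.trans subset_union_left
  have hRchF : ∀ c ∈ R, IsChord I F c := fun c hc =>
    isChord_union_of_clean I hT hKH hHM hHin (memC'' c (mem_sdiff.1 hc).1).2.1 (memC'' c (mem_sdiff.1 hc).1).2.2.1
  have hRdegF : ∀ c ∈ R, ∀ w ∈ xpair I c, 2 + (R.filter fun j => w ∈ varSet I j).card ≤ degIn I F w := fun c hc w hw => by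
    have h1 := hRdeg c hc w hw
    rw [hF, degIn_union I hKH]
    omega
  have hdel := card_bdry_sdiff_add_le I hI F R hRF hRchF hRdegF
  have hFr : (F \ R).card ≤ r := by
    refine le_trans (card_le_card fun f hf => ?_) ht.2.2.2.2.2.1
    rcases mem_union.1 (mem_sdiff.1 hf).1 with h | h
    · exact mem_union_left _ (mem_union_left _ h)
    · rw [union_assoc]; exact mem_union_right _ (hHM h)
  have hexp := hB (F \ R) hFr
  have hFR : (F \ R).card + R.card = F.card := card_sdiff_add_card_eq_card hRF
  have hFcard : F.card = K.card + H.card := by rw [hF, card_union_of_disjoint hKH]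
  -- one covered private slot per dirty chord leaves the boundary
  have hVex : ∀ d ∈ D, ∃ v, (v = I.vars d 2 ∨ v = I.vars d 3) ∧ ∃ h ∈ H, v ∈ varSet I h := fun d hd => by
    obtain ⟨hdK, hch, hO⟩ := mem_filter.1 hd
    obtain ⟨h, hh, h23⟩ := hcover d hdK hch hO
    rcases h23 with h2 | h3
    · exact ⟨_, Or.inl rfl, h, hh, h2⟩
    · exact ⟨_, Or.inr rfl, h, hh, h3⟩
  choose ν hν23 hνH using hVex
  set vf : Fin m → Fin n := fun d => if h : d ∈ D then ν d h else I.vars d 2 with hvf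
  have hvfD : ∀ d (hd : d ∈ D), vf d = ν d hd := fun d hd => by simp only [hvf, dif_pos hd]
  have hvbd : ∀ d ∈ D, vf d ∈ bdry I K ∧ vf d ∈ varSet I d := fun d hd => by
    obtain ⟨hdK, hch, -⟩ := mem_filter.1 hd
    rw [hvfD d hd]
    rcases hν23 d hd with h | h <;> rw [h]
    · exact ⟨hch.1, vars_mem_varSet I d 2⟩
    · exact ⟨hch.2, vars_mem_varSet I d 3⟩
  set V := D.image vf with hVdef
  have hVb : V ⊆ bdry I K := fun v hv => by
    obtain ⟨d, hd, rfl⟩ := mem_image.1 hv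
    exact (hvbd d hd).1
  have hVH : ∀ v ∈ V, ∃ h ∈ H, v ∈ varSet I h := fun v hv => by
    obtain ⟨d, hd, rfl⟩ := mem_image.1 hv
    rw [hvfD d hd]
    exact hνH d hd
  have hVcard : V.card = D.card := by
    refine card_image_of_injOn fun d hd d' hd' h => ?_
    have hd₀ : d ∈ D := mem_coe.1 hd
    have hd₀' : d' ∈ D := mem_coe.1 hd'
    by_contra hne
    have hb := (hvbd d hd₀).1
    rw [mem_bdry_iff] at hb
    unfold PstarSAClosure.degIn at hb
    have two : ({d, d'} : Finset (Fin m)) ⊆ K.filter fun j => vf d ∈ varSet I j := by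
      intro j hj
      rcases mem_insert.1 hj with rfl | hj
      · exact mem_filter.2 ⟨(mem_filter.1 hd₀).1, (hvbd j hd₀).2⟩
      · rw [mem_singleton.1 hj]
        exact mem_filter.2 ⟨(mem_filter.1 hd₀').1, h ▸ (hvbd d' hd₀').2⟩
    have := card_le_card two
    rw [card_pair hne] at this
    omega
  have hbF := card_bdry_union_le I hKH hHin hVb hVH
  rw [← hF] at hbF
  have hRcard : R.card + Kept.card = C''.card := by rw [hR, card_sdiff_add_card_eq_card hKeptC]
  have hWY := card_le_card hW₁Y
  omega

/-- **NO CENTRE WITH AT MOST TWO DIRTY CHORDS** (every slack, all sharing patterns; inside the induction). -/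
theorem no_centre_of_dirty_le_two (hI : I.IsPure xorAndPred) (hT : Typed I) (hS : SimpleOverlap I) (hB : BoundaryExpanding r I)
    (ht : Terminal I r y K w₁ w₂)
    (hIH : ∀ c ∈ K, ∀ K₀ ⊆ K.erase c, ∀ d d' : Finset (Fin n) × Finset (Fin m) × Bool, Terminal I r y K₀ d d' → K₀.card ≤ 5)
    (hconn : XConnected I K) {D : Finset (Fin m)} (hD2 : D.card ≤ 2)
    (hD : ∀ d ∈ K, IsChord I K d → ¬ OutsideGated I K (w₁.2.1 ∪ w₂.2.1) d → d ∈ D) :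
    ¬ ∃ S ⊆ K, S.Nonempty ∧ (∀ w ∈ xverts I S, 2 ≤ xpdeg I S w) ∧ ∀ f ∈ S, ¬ IsChord I K f := by
  classical
  have hdisj : Disjoint K (w₁.2.1 ∪ w₂.2.1) := disjoint_union_right.2 ⟨ht.2.2.2.1, ht.2.2.2.2.1⟩
  set D' := D.filter fun d => d ∈ K ∧ IsChord I K d ∧ ¬ OutsideGated I K (w₁.2.1 ∪ w₂.2.1) d with hD'
  have hg : ∀ d ∈ D', ∃ g ∈ w₁.2.1 ∪ w₂.2.1, ((∃ j ∈ K, I.vars g 2 ∈ varSet I j) ∧ ∃ j ∈ K, I.vars g 3 ∈ varSet I j) ∧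
      (I.vars d 2 ∈ varSet I g ∨ I.vars d 3 ∈ varSet I g) := fun d hd => by
    obtain ⟨-, hdK, hch, hO⟩ := mem_filter.1 hd
    obtain ⟨g, hgM, -, hg2, hg3, v, hv, hvg, -⟩ := exists_inside_gate I hdisj hdK hch hO
    refine ⟨g, hgM, ⟨hg2, hg3⟩, ?_⟩
    rcases hv with rfl | rfl
    · exact Or.inl hvg
    · exact Or.inr hvg
  choose γ hγM hγin hγd using hg
  obtain ⟨d₀, -⟩ := ht.1
  set gf : Fin m → Fin m := fun d => if h : d ∈ D' then γ d h else d₀ with hgf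
  refine no_centre_of_gate_cover hI hT hS hB ht hIH hconn (H := D'.image gf) (fun g hg' => ?_)
    ((card_image_le.trans (card_filter_le _ _)).trans hD2) (fun g hg' => ?_) fun d hdK hch hO => ?_
  · obtain ⟨d, hd, rfl⟩ := mem_image.1 hg'
    simp only [hgf, dif_pos hd]
    exact hγM d hd
  · obtain ⟨d, hd, rfl⟩ := mem_image.1 hg'
    simp only [hgf, dif_pos hd]
    exact hγin d hd
  · have hd : d ∈ D' := mem_filter.2 ⟨hD d hdK hch hO, hdK, hch, hO⟩
    refine ⟨gf d, mem_image_of_mem _ hd, ?_⟩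
    simp only [hgf, dif_pos hd]
    exact hγd d hd

/-- **A CENTRE FORCES THREE DIRTY CHORDS** (every slack, all sharing patterns; inside the induction): an X-connected terminal core with a non-empty
leafless set of non-chords has three pairwise distinct chords that are not outside-gated. -/
theorem exists_three_dirty_of_centre (hI : I.IsPure xorAndPred) (hT : Typed I) (hS : SimpleOverlap I) (hB : BoundaryExpanding r I)
    (ht : Terminal I r y K w₁ w₂)
    (hIH : ∀ c ∈ K, ∀ K₀ ⊆ K.erase c, ∀ d d' : Finset (Fin n) × Finset (Fin m) × Bool, Terminal I r y K₀ d d' → K₀.card ≤ 5)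
    (hconn : XConnected I K) (hcentre : ∃ S ⊆ K, S.Nonempty ∧ (∀ w ∈ xverts I S, 2 ≤ xpdeg I S w) ∧ ∀ f ∈ S, ¬ IsChord I K f) :
    ∃ D ⊆ K, D.card = 3 ∧ ∀ d ∈ D, IsChord I K d ∧ ¬ OutsideGated I K (w₁.2.1 ∪ w₂.2.1) d := by
  classical
  set Dall := K.filter fun d => IsChord I K d ∧ ¬ OutsideGated I K (w₁.2.1 ∪ w₂.2.1) d with hDall
  by_cases h3 : 3 ≤ Dall.card
  · obtain ⟨D, hD, hcard⟩ := exists_subset_card_eq h3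
    exact ⟨D, fun d hd => (mem_filter.1 (hD hd)).1, hcard, fun d hd => (mem_filter.1 (hD hd)).2⟩
  · exfalso
    exact no_centre_of_dirty_le_two hI hT hS hB ht hIH hconn (D := Dall) (by omega)
      (fun d hdK hch hO => mem_filter.2 ⟨hdK, hch, hO⟩) hcentre

end Summit.PneNP.PneNP.Theorems.PstarCentreThreeGates
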